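import Mathlib
import HarnessLib
import Summits.Ventures.LatticeQCDFlow.Exactness.NCMCGeneralSpaceRelativeEntropy
import Summits.Ventures.LatticeQCDFlow.Scaling.GaussianWeights

/-!
# The work marginals: Crooks' fluctuation theorem on a general state space, and the Gaussian-work case

HONEST FRAMING: exact (Metropolis-corrected) sampling algorithms for lattice gauge theory;
figures of merit are autocorrelation/cost numbers at stated couplings and volumes; no
continuum-physics claim.

Venture `LatticeQCDFlow` (cell pub-lqcd), topic `Exactness`; FANOUT row 13 (`eng-snf`, GEN-10).
NEW WORK of the cell (general measure theory, elementary), not a published result; nothing is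
cited as a fact (G. E. Crooks, Phys. Rev. E 60 (1999) 2721 "work fluctuation theorem";
C. Jarzynski 1997 named only).  Setting of `NCMCGeneralSpace.lean` /
`NCMCGeneralSpaceRelativeEntropy.lean`: a Crooks pair from `ν₀` to `ν₁` on a general measurable
state space, normalised record laws `P_F`, `P_R` on one space of records, `e^{−ΔF} = Z₁/Z₀`; here
everything is pushed forward along the work `W : E → ℝ` to the real line.

## Content

* `map_tilted_comp` — pushing an exponential tilt of the form `f ∘ g` forward along `g`
  (bookkeeping; the density version is inlined where used).
* **`CrooksPair.map_work_fwdPathLaw_eq_withDensity`** — CROOKS' WORK FLUCTUATION THEOREM on a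
  general state space: the law of `W` under `P_F` is the law of `W` under `P_R` tilted by
  `e^{w − ΔF}`, `P_F(W ∈ dw) = e^{w − ΔF} · P_R(W ∈ dw)` (the reverse protocol's own work on that
  record being `−w`, this is `p_F(w) / p_rev(−w) = e^{w − ΔF}` for densities);
  `map_work_revPathLaw_eq_withDensity` (the same read backwards, density `e^{ΔF − w}`) and
  `map_work_revPathLaw_eq_tilted` (`= (P_F ∘ W⁻¹).tilted (−id)`, hypothesis-free in `ΔF`).
* `gaussianReal_withDensity_exp_linear` — the exponential tilt of a Gaussian is a Gaussian with
  shifted mean: `N(m, v) · e^{t w − (m t + v t²/2)} = N(m + v t, v)` (every `v`, also degenerate).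
* THE GAUSSIAN-WORK CASE (hypothesis `(P_F).map W = gaussianReal m v`; this is the law behind
  row 8's `Scaling/GaussianWorkDictionary.lean` and theory-2's T2-J `Theory2.gaussian_logweight_law`
  of `Scaling/GaussianWeights.lean`, which this file USES): **`CrooksPair.freeEnergyDiff_eq_of_gaussian`** — Jarzynski FORCES `ΔF = m − v/2`;
  `integral_work_of_gaussian` (`E_F[W] = m`), `dissipation_of_gaussian` (`E_F[W] − ΔF = v/2`: the
  mean dissipated work is half the work variance), `essPop_of_gaussian_work` (population ESS `= e^{−v}`,
  forward lane alone),
  **`map_work_revPathLaw_of_gaussian`** — the work on REVERSE records is Gaussian `N(m − v, v)`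
  (Crooks' tilt of a Gaussian), hence `integral_work_rev_of_gaussian` (`E_R[W] = m − v`) and
  `rev_dissipation_of_gaussian` (`ΔF − E_R[W] = v/2`: both lanes dissipate `v/2`), and
  `essPop_of_gaussian_lt_bound` — for `v ≠ 0` the general bound
  `ESS_F ≤ e^{−⟨W_d⟩_rev}` of `NCMCGeneralSpaceDissipation.lean` reads `e^{−v} < e^{−v/2}`: the
  Jensen bound is off by a factor two in the exponent exactly in the Gaussian regime (a statement
  about the bound's tightness, not about any protocol).

A finite path space never has Gaussian work; the Gaussian case is the continuum idealisation the
engine's planning numbers (`eqscan.metropolized_gaussian`, 0.1.10.dev0) use — typed here as an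
implication from the hypothesis, for any Crooks pair on any measurable state space.
-/

namespace Summit.Ventures.LatticeQCDFlow.Exactness.GeneralNCMC

open MeasureTheory ProbabilityTheory Set Filter
open scoped ENNReal NNReal

/-! ## Pushing densities and tilts forward -/

/-- Pushing an exponential tilt by `f ∘ g` forward along `g`: `(μ.tilted (f ∘ g)) ∘ g⁻¹ =
(μ ∘ g⁻¹).tilted f`. -/
theorem map_tilted_comp {α β : Type*} [MeasurableSpace α] [MeasurableSpace β] (μ : Measure α)
    {g : α → β} (hg : Measurable g) {f : β → ℝ} (hf : Measurable f) :
    (μ.tilted (f ∘ g)).map g = (μ.map g).tilted f := by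
  have hF : AEStronglyMeasurable (fun y => Real.exp (f y)) (μ.map g) :=
    (Real.measurable_exp.comp hf).aestronglyMeasurable
  have hint : ∫ x, Real.exp (f (g x)) ∂μ = ∫ y, Real.exp (f y) ∂(μ.map g) := by
    rw [integral_map hg.aemeasurable hF]
  set D : β → ℝ≥0∞ := fun y => ENNReal.ofReal (Real.exp (f y) / ∫ y, Real.exp (f y) ∂(μ.map g))
    with hD
  have hd : Measurable D := ((Real.measurable_exp.comp hf).div_const _).ennreal_ofReal
  have heq : (fun x => ENNReal.ofReal (Real.exp ((f ∘ g) x) / ∫ x, Real.exp ((f ∘ g) x) ∂μ)) =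
      fun x => D (g x) := by
    funext x
    simp only [hD, Function.comp_apply]
    rw [hint]
  rw [Measure.tilted, Measure.tilted, heq]
  ext s hs
  rw [Measure.map_apply hg hs, withDensity_apply _ (hg hs), withDensity_apply _ hs,
    setLIntegral_map hs hd hg]

/-! ## The exponential tilt of a Gaussian -/

/-- **The exponential tilt of a Gaussian is a Gaussian with shifted mean**: for every `t`,
`N(m, v) · e^{t w − (m t + v t² / 2)} = N(m + v t, v)` (the density is normalised by the Gaussian
moment-generating function; `v = 0` is the Dirac case). -/
theorem gaussianReal_withDensity_exp_linear (m : ℝ) (v : ℝ≥0) (t : ℝ) :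
    (gaussianReal m v).withDensity
        (fun w => ENNReal.ofReal (Real.exp (t * w - (m * t + (v : ℝ) * t ^ 2 / 2)))) =
      gaussianReal (m + (v : ℝ) * t) v := by
  by_cases hv : v = 0
  · subst hv
    have h1 : ENNReal.ofReal (Real.exp (t * m - (m * t + ((0 : ℝ≥0) : ℝ) * t ^ 2 / 2))) = 1 := by
      rw [NNReal.coe_zero, show t * m - (m * t + 0 * t ^ 2 / 2) = 0 by ring, Real.exp_zero,
        ENNReal.ofReal_one]
    rw [gaussianReal_zero_var, gaussianReal_zero_var, dirac_withDensity, h1, one_smul,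
      NNReal.coe_zero, zero_mul, add_zero]
  have hvr : (v : ℝ) ≠ 0 := NNReal.coe_ne_zero.2 hv
  have hmeas : Measurable fun w => ENNReal.ofReal (Real.exp (t * w - (m * t + (v : ℝ) * t ^ 2 / 2))) :=
    (Real.measurable_exp.comp ((measurable_const.mul measurable_id).sub measurable_const)).ennreal_ofReal
  rw [gaussianReal_of_var_ne_zero _ hv, gaussianReal_of_var_ne_zero _ hv,
    ← withDensity_mul _ (measurable_gaussianPDF m v) hmeas]
  congr 1
  funext w
  simp only [Pi.mul_apply, gaussianPDF]
  rw [← ENNReal.ofReal_mul (gaussianPDFReal_nonneg _ _ _)]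
  congr 1
  rw [gaussianPDFReal_def, gaussianPDFReal_def]
  simp only
  rw [mul_assoc, ← Real.exp_add]
  congr 2
  field_simp
  ring

/-- The tilt parameter `t = −1`: `N(m, v) · e^{(m − v/2) − w} = N(m − v, v)` — the form in which
Crooks' theorem tilts a Gaussian forward work law into the reverse one. -/
theorem gaussianReal_withDensity_exp_sub (m : ℝ) (v : ℝ≥0) :
    (gaussianReal m v).withDensity (fun w => ENNReal.ofReal (Real.exp (m - (v : ℝ) / 2 - w))) =
      gaussianReal (m - (v : ℝ)) v := by
  have h := gaussianReal_withDensity_exp_linear m v (-1)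
  have hfun : (fun w => ENNReal.ofReal (Real.exp (-1 * w - (m * -1 + (v : ℝ) * (-1) ^ 2 / 2)))) =
      fun w => ENNReal.ofReal (Real.exp (m - (v : ℝ) / 2 - w)) := by
    funext w
    congr 2
    ring
  rw [hfun, show m + (v : ℝ) * -1 = m - (v : ℝ) by ring] at h
  exact h

variable {Ω E : Type*} [MeasurableSpace Ω] [MeasurableSpace E]

/-! ## The population ESS for a Gaussian work law -/

/-- **The population ESS of the Jarzynski weights is `e^{−v}`** for a Gaussian forward work law
(a property of the forward lane alone; T2-J `gaussian_logweight_ess` in the engine's variables). -/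
theorem essPop_of_gaussian_work {ν₀ : Measure Ω} {κF : Kernel Ω E} {W : E → ℝ} {m : ℝ} {v : ℝ≥0}
    (hW : (fwdPathLaw ν₀ κF).map W = gaussianReal m v) :
    (∫ ε, Real.exp (-W ε) ∂(fwdPathLaw ν₀ κF)) ^ 2 /
        ∫ ε, Real.exp (-(2 * W ε)) ∂(fwdPathLaw ν₀ κF) = Real.exp (-(v : ℝ)) := by
  have e1 : ∫ ε, Real.exp (-W ε) ∂(fwdPathLaw ν₀ κF) = Real.exp (m * (-1) + v * (-1) ^ 2 / 2) := by
    have := mgf_gaussianReal hW (-1)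
    simpa only [mgf, neg_mul, one_mul] using this
  have e2 : ∫ ε, Real.exp (-(2 * W ε)) ∂(fwdPathLaw ν₀ κF) =
      Real.exp (m * (-2) + v * (-2) ^ 2 / 2) := by
    have := mgf_gaussianReal hW (-2)
    simpa only [mgf, neg_mul] using this
  rw [e1, e2, sq, ← Real.exp_add, ← Real.exp_sub]
  congr 1
  ring

namespace CrooksPair

variable {ν₀ ν₁ : Measure Ω} {κF κR : Kernel Ω E} {s e : E → Ω} {W : E → ℝ}

/-! ## Crooks' work fluctuation theorem -/

/-- **The law of the work on reverse records is the forward work law tilted by `e^{ΔF − w}`.** -/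
theorem map_work_revPathLaw_eq_withDensity [IsFiniteMeasure ν₀] [IsFiniteMeasure ν₁]
    [IsMarkovKernel κR] (h0 : ν₀ univ ≠ 0) (h1 : ν₁ univ ≠ 0)
    (h : CrooksPair ν₀ ν₁ κF κR s e W) {ΔF : ℝ}
    (hΔF : Real.exp (-ΔF) = ((ν₀ univ)⁻¹ * ν₁ univ).toReal) :
    (fwdPathLaw ν₁ κR).map W =
      ((fwdPathLaw ν₀ κF).map W).withDensity fun w => ENNReal.ofReal (Real.exp (ΔF - w)) := by
  have hf : Measurable fun w : ℝ => ENNReal.ofReal (Real.exp (ΔF - w)) :=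
    (Real.measurable_exp.comp (measurable_const.sub measurable_id)).ennreal_ofReal
  rw [h.revPathLaw_eq_withDensity h0 h1 hΔF]
  ext B hB
  rw [Measure.map_apply h.measurable_W hB, withDensity_apply _ (h.measurable_W hB),
    withDensity_apply _ hB, setLIntegral_map hB hf h.measurable_W]

/-- **Crooks' work fluctuation theorem on a general state space**: the law of the work on forward
records is the law of the work on reverse records tilted by `e^{w − ΔF}`,
`P_F(W ∈ dw) = e^{w − ΔF} P_R(W ∈ dw)` — for densities, with the reverse protocol's own work `−w`,
`p_F(w) / p_rev(−w) = e^{w − ΔF}`.  Any Crooks pair: stochastic steps with their adjoints,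
Jacobian-charged layers, concatenations. -/
theorem map_work_fwdPathLaw_eq_withDensity [IsFiniteMeasure ν₀] [IsFiniteMeasure ν₁]
    [IsMarkovKernel κF] (h0 : ν₀ univ ≠ 0) (h1 : ν₁ univ ≠ 0)
    (h : CrooksPair ν₀ ν₁ κF κR s e W) {ΔF : ℝ}
    (hΔF : Real.exp (-ΔF) = ((ν₀ univ)⁻¹ * ν₁ univ).toReal) :
    (fwdPathLaw ν₀ κF).map W =
      ((fwdPathLaw ν₁ κR).map W).withDensity fun w => ENNReal.ofReal (Real.exp (w - ΔF)) := by
  have hf : Measurable fun w : ℝ => ENNReal.ofReal (Real.exp (w - ΔF)) :=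
    (Real.measurable_exp.comp (measurable_id.sub measurable_const)).ennreal_ofReal
  rw [h.fwdPathLaw_eq_withDensity h0 h1 hΔF]
  ext B hB
  rw [Measure.map_apply h.measurable_W hB, withDensity_apply _ (h.measurable_W hB),
    withDensity_apply _ hB, setLIntegral_map hB hf h.measurable_W]

/-- The same as an exponential tilt, with no reference to `ΔF`: `P_R ∘ W⁻¹ = (P_F ∘ W⁻¹).tilted (−id)`. -/
theorem map_work_revPathLaw_eq_tilted [IsFiniteMeasure ν₀] [IsFiniteMeasure ν₁] [IsMarkovKernel κR]
    (h0 : ν₀ univ ≠ 0) (h1 : ν₁ univ ≠ 0) (h : CrooksPair ν₀ ν₁ κF κR s e W) :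
    (fwdPathLaw ν₁ κR).map W = ((fwdPathLaw ν₀ κF).map W).tilted fun w => -w := by
  rw [h.revPathLaw_eq_tilted h0 h1,
    show (fun ε => -W ε) = (fun w : ℝ => -w) ∘ W from rfl]
  exact map_tilted_comp (fwdPathLaw ν₀ κF) h.measurable_W measurable_neg

/-! ## The Gaussian-work case -/

section Gaussian

variable {m : ℝ} {v : ℝ≥0}

/-- **Jarzynski forces `ΔF = m − v/2` for a Gaussian forward work law `N(m, v)`** (T2-J
`gaussian_logweight_law` applied to the log-weight `ΔF − W`, whose exponential has mean one). -/
theorem freeEnergyDiff_eq_of_gaussian [IsMarkovKernel κR] (h : CrooksPair ν₀ ν₁ κF κR s e W) {ΔF : ℝ}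
    (hΔF : Real.exp (-ΔF) = ((ν₀ univ)⁻¹ * ν₁ univ).toReal)
    (hW : (fwdPathLaw ν₀ κF).map W = gaussianReal m v) : ΔF = m - (v : ℝ) / 2 := by
  have hsub : Measurable fun x : ℝ => ΔF - x := measurable_const.sub measurable_id
  have hℓ : (fwdPathLaw ν₀ κF).map (fun ε => ΔF - W ε) = gaussianReal (ΔF - m) v := by
    rw [show (fun ε => ΔF - W ε) = (fun x : ℝ => ΔF - x) ∘ W from rfl,
      ← Measure.map_map hsub h.measurable_W, hW, gaussianReal_map_const_sub]
  have hnorm : mgf (fun ε => ΔF - W ε) (fwdPathLaw ν₀ κF) 1 = 1 := by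
    simp only [mgf, one_mul]
    have hsplit : ∀ ε, Real.exp (ΔF - W ε) = Real.exp ΔF * Real.exp (-W ε) := fun ε => by
      rw [sub_eq_add_neg, Real.exp_add]
    simp_rw [hsplit]
    rw [integral_const_mul, h.integral_exp_neg_work, ← hΔF, ← Real.exp_add, add_neg_cancel,
      Real.exp_zero]
  have key := (Theory2.gaussian_logweight_law hℓ hnorm).1
  linarith

/-- For a Gaussian forward work law, `E_F[W] = m`. -/
theorem integral_work_of_gaussian (h : CrooksPair ν₀ ν₁ κF κR s e W)
    (hW : (fwdPathLaw ν₀ κF).map W = gaussianReal m v) :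
    ∫ ε, W ε ∂(fwdPathLaw ν₀ κF) = m := by
  have hid : ∫ w, w ∂((fwdPathLaw ν₀ κF).map W) = ∫ ε, W ε ∂(fwdPathLaw ν₀ κF) :=
    integral_map h.measurable_W.aemeasurable measurable_id.aestronglyMeasurable
  rw [← hid, hW, integral_id_gaussianReal]

/-- **The mean dissipated work is half the work variance**: `E_F[W] − ΔF = v/2`. -/
theorem dissipation_of_gaussian [IsMarkovKernel κR] (h : CrooksPair ν₀ ν₁ κF κR s e W) {ΔF : ℝ}
    (hΔF : Real.exp (-ΔF) = ((ν₀ univ)⁻¹ * ν₁ univ).toReal)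
    (hW : (fwdPathLaw ν₀ κF).map W = gaussianReal m v) :
    ∫ ε, W ε ∂(fwdPathLaw ν₀ κF) - ΔF = (v : ℝ) / 2 := by
  rw [h.integral_work_of_gaussian hW, h.freeEnergyDiff_eq_of_gaussian hΔF hW]
  ring

/-- **Crooks tilts a Gaussian into a Gaussian**: for a Gaussian forward work law `N(m, v)` the law of
the work on REVERSE records is `N(m − v, v)` (so the reverse protocol's own work `−W` is
`N(v − m, v)`, and the two work histograms cross at `w = ΔF = m − v/2`). -/
theorem map_work_revPathLaw_of_gaussian [IsFiniteMeasure ν₀] [IsFiniteMeasure ν₁]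
    [IsMarkovKernel κF] [IsMarkovKernel κR] (h0 : ν₀ univ ≠ 0) (h1 : ν₁ univ ≠ 0)
    (h : CrooksPair ν₀ ν₁ κF κR s e W) (hW : (fwdPathLaw ν₀ κF).map W = gaussianReal m v) :
    (fwdPathLaw ν₁ κR).map W = gaussianReal (m - (v : ℝ)) v := by
  have hΔF := exp_neg_freeEnergyDiff (ν₀ := ν₀) (ν₁ := ν₁) h0 h1
  rw [h.map_work_revPathLaw_eq_withDensity h0 h1 hΔF, hW, h.freeEnergyDiff_eq_of_gaussian hΔF hW]
  exact gaussianReal_withDensity_exp_sub m v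

/-- For a Gaussian forward work law, `E_R[W] = m − v`. -/
theorem integral_work_rev_of_gaussian [IsFiniteMeasure ν₀] [IsFiniteMeasure ν₁]
    [IsMarkovKernel κF] [IsMarkovKernel κR] (h0 : ν₀ univ ≠ 0) (h1 : ν₁ univ ≠ 0)
    (h : CrooksPair ν₀ ν₁ κF κR s e W) (hW : (fwdPathLaw ν₀ κF).map W = gaussianReal m v) :
    ∫ ε, W ε ∂(fwdPathLaw ν₁ κR) = m - (v : ℝ) := by
  have hid : ∫ w, w ∂((fwdPathLaw ν₁ κR).map W) = ∫ ε, W ε ∂(fwdPathLaw ν₁ κR) :=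
    integral_map h.measurable_W.aemeasurable measurable_id.aestronglyMeasurable
  rw [← hid, h.map_work_revPathLaw_of_gaussian h0 h1 hW, integral_id_gaussianReal]

/-- **Both lanes dissipate `v/2`**: the reverse lane's mean dissipated work `ΔF − E_R[W]` is `v/2`
as well. -/
theorem rev_dissipation_of_gaussian [IsFiniteMeasure ν₀] [IsFiniteMeasure ν₁]
    [IsMarkovKernel κF] [IsMarkovKernel κR] (h0 : ν₀ univ ≠ 0) (h1 : ν₁ univ ≠ 0)
    (h : CrooksPair ν₀ ν₁ κF κR s e W) {ΔF : ℝ}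
    (hΔF : Real.exp (-ΔF) = ((ν₀ univ)⁻¹ * ν₁ univ).toReal)
    (hW : (fwdPathLaw ν₀ κF).map W = gaussianReal m v) :
    ΔF - ∫ ε, W ε ∂(fwdPathLaw ν₁ κR) = (v : ℝ) / 2 := by
  rw [h.integral_work_rev_of_gaussian h0 h1 hW, h.freeEnergyDiff_eq_of_gaussian hΔF hW]
  ring

/-- **Tightness of the dissipation bound in the Gaussian regime**: the general bound
`ESS_F ≤ exp(−E_R[ΔF − W])` of `NCMCGeneralSpaceDissipation.lean` reads `e^{−v} ≤ e^{−v/2}` here,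
strict for `v ≠ 0` — the Jensen bound is off by a factor two in the exponent exactly when the work
is Gaussian. -/
theorem essPop_of_gaussian_lt_bound [IsFiniteMeasure ν₀] [IsFiniteMeasure ν₁]
    [IsMarkovKernel κF] [IsMarkovKernel κR] (h0 : ν₀ univ ≠ 0) (h1 : ν₁ univ ≠ 0)
    (h : CrooksPair ν₀ ν₁ κF κR s e W) {ΔF : ℝ}
    (hΔF : Real.exp (-ΔF) = ((ν₀ univ)⁻¹ * ν₁ univ).toReal)
    (hW : (fwdPathLaw ν₀ κF).map W = gaussianReal m v) (hv : v ≠ 0) :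
    (∫ ε, Real.exp (-W ε) ∂(fwdPathLaw ν₀ κF)) ^ 2 /
        ∫ ε, Real.exp (-(2 * W ε)) ∂(fwdPathLaw ν₀ κF) <
      Real.exp (-∫ ε, (ΔF - W ε) ∂(fwdPathLaw ν₁ κR)) := by
  haveI := isProbabilityMeasure_fwdPathLaw ν₁ h1 κR
  have hWint : Integrable W (fwdPathLaw ν₁ κR) := by
    have hid : Integrable id ((fwdPathLaw ν₁ κR).map W) := by
      rw [h.map_work_revPathLaw_of_gaussian h0 h1 hW]
      have hm := memLp_id_gaussianReal (μ := m - (v : ℝ)) (v := v) 1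
      rw [ENNReal.coe_one] at hm
      exact memLp_one_iff_integrable.1 hm
    exact (integrable_map_measure measurable_id.aestronglyMeasurable
      h.measurable_W.aemeasurable).1 hid
  rw [essPop_of_gaussian_work hW, integral_sub (integrable_const ΔF) hWint, integral_const, smul_eq_mul,
    probReal_univ, one_mul, h.rev_dissipation_of_gaussian h0 h1 hΔF hW, Real.exp_lt_exp]
  have hvpos : 0 < (v : ℝ) := lt_of_le_of_ne v.2 (Ne.symm (NNReal.coe_ne_zero.2 hv))
  linarith

end Gaussian

end CrooksPair

end Summit.Ventures.LatticeQCDFlow.Exactness.GeneralNCMC
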